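import Literature.Topology.FourManifolds.ManolescuPiccirillo2023CensusHolds
import Literature.Topology.FourManifolds.KnotsProofs
import Literature.Topology.FourManifolds.SliceRibbon
import Literature.Topology.FourManifolds.LinkSurgeryExistence
import HarnessLib

/-!
# REVIEW-RUNBOOK sanity lemmas — the Manolescu–Piccirillo census criterion (pub-sp4mp)

Evidence-scope module for the review runbook of
`Literature.Topology.FourManifolds.MPCensus.exotic_of_flagged_pair_holds` /
`MPCensus.crux_of_flagged_pair` (cell pub-sp4mp, `papers/SmoothPoincare4/sp4-mp-census`;
route item stmt-SmoothPoincare4-0366 `Literature.Uncategorized.Crux`).  Card (2)(b) items of the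
runbook, kernel-checked:

* the carrier `Knot` the criterion quantifies over is INHABITED (the unknot; the smoothness facts of
  the sphere inclusion it relies on are the PROVED instance `SphereEmbedding.smoothnessFacts`);
* `MPCensus.CommonZeroSurgery` is reflexive (surgery on a framed link exists —
  `FramedLink.exists_isSurgery_holds`), so the hypothesis `h0` is satisfiable;
* `MPCensus.SliceObstruction` is satisfiable (the zero invariant) and is never satisfied together
  with the flag `s K' ≠ 0` at `K' = unknot` (the unknot is smoothly slice, `isSmoothlySlice_unknot`);
* hence three of the four hypotheses of `exotic_of_flagged_pair_holds` hold JOINTLY on an explicit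
  triple `(s, K, K') = (0, unknot, unknot)` while the fourth fails there: the content of the
  criterion is exactly the census datum — a pair with a common `0`-surgery, `K` slice and
  `s(K') ≠ 0` for an `s` obeying Rasmussen's obstruction (0 such pairs in the census of record).

Nothing here is a new mathematical claim; every statement is a one-line consequence of tree
theorems.  No `sorry`, standard axioms.
-/

open scoped Manifold ContDiff

-- D-0017 layout `Summit.<Summit>.<Problem>…` repeats the summit name for single-problem summits (gate passes -Dweak.linter.dupNamespace=false under Summits/)
set_option linter.dupNamespace false

namespace Summit.SmoothPoincare4.SmoothPoincare4.Theorems.RunbookMPCensus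

open Literature.Topology.FourManifolds

/-- (b) The carrier `Knot` (= `SphereEmbedding 1 3`) quantified over by the census criterion is
inhabited: the unknot (standard great circle), the instance hypothesis
`[SphereEmbedding.SmoothnessFacts]` being discharged by the proved instance
`SphereEmbedding.smoothnessFacts` (`KnotsProofs`). [folklore] -/
theorem nonempty_knot : Nonempty Knot := ⟨unknot⟩

/-- (b) `CommonZeroSurgery` is reflexive: every knot has a common `0`-surgery with itself — the
`0`-surgery `Y` on `K` exists (`FramedLink.exists_isSurgery_holds`, Rolfsen §9.F / Juhász Def. 4.95)
and serves twice. Hence hypothesis `h0` of `exotic_of_flagged_pair_holds` is satisfiable. [folklore] -/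
theorem commonZeroSurgery_refl (K : Knot) : MPCensus.CommonZeroSurgery K K := by
  obtain ⟨Y, _, _, _, _, _, _, hY⟩ := FramedLink.exists_isSurgery_holds (FramedLink.single K 0)
  exact ⟨Y, _, _, hY, hY⟩

/-- (b) `CommonZeroSurgery` holds on an explicit instance (the unknot with itself). [folklore] -/
theorem commonZeroSurgery_unknot : MPCensus.CommonZeroSurgery unknot unknot :=
  commonZeroSurgery_refl unknot

/-- (b) `SliceObstruction` is satisfiable: the zero invariant `s ≡ 0` obeys it (trivially —
which is the point: the obstruction alone carries no content without a knot where `s ≠ 0`). [folklore] -/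
theorem sliceObstruction_zero : MPCensus.SliceObstruction (fun _ => 0) := fun _ _ => rfl

/-- (b) `SliceObstruction` FAILS on an explicit instance: the constant invariant `s ≡ 1` does not
obey it, witnessed by the unknot (smoothly slice, `isSmoothlySlice_unknot`, Fox 1962). [folklore] -/
theorem not_sliceObstruction_one : ¬ MPCensus.SliceObstruction (fun _ => 1) :=
  fun h => one_ne_zero (h unknot isSmoothlySlice_unknot)

/-- (b) For EVERY invariant obeying the slice obstruction the flag `s K' ≠ 0` fails at
`K' = unknot`: the unknot is never the obstructed partner of a flagged pair. [folklore] -/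
theorem flag_fails_at_unknot {s : Knot → ℤ} (h : MPCensus.SliceObstruction s) : s unknot = 0 :=
  h unknot isSmoothlySlice_unknot

/-- (b) Joint satisfiability of the criterion's hypotheses MINUS the flag: on the explicit triple
`(s, K, K') = (0, unknot, unknot)` the slice obstruction, the common `0`-surgery and "`K` smoothly
slice" hold together, and the flag `s K' ≠ 0` is false there. So `exotic_of_flagged_pair_holds` is
not vacuous through its standing hypotheses; its content is the census datum (a flagged pair). [folklore] -/
theorem hypotheses_without_flag_jointly_satisfiable :
    ∃ (s : Knot → ℤ) (K K' : Knot),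
      MPCensus.SliceObstruction s ∧ MPCensus.CommonZeroSurgery K K' ∧ K.IsSmoothlySlice ∧ s K' = 0 :=
  ⟨fun _ => 0, unknot, unknot, sliceObstruction_zero, commonZeroSurgery_unknot, isSmoothlySlice_unknot, rfl⟩

/-- (b) The census criterion applied at a flagged pair is NOT derivable from the unknot: with
`K' = unknot` the four hypotheses of `exotic_of_flagged_pair_holds` are CONTRADICTORY (no exotic
sphere is produced from nothing). [folklore] -/
theorem hypotheses_inconsistent_at_unknot {s : Knot → ℤ} (hRas : MPCensus.SliceObstruction s)
    {K : Knot} (_h0 : MPCensus.CommonZeroSurgery K unknot) (hs : s unknot ≠ 0) : False :=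
  hs (flag_fails_at_unknot hRas)

end Summit.SmoothPoincare4.SmoothPoincare4.Theorems.RunbookMPCensus
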